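import Mathlib.LinearAlgebra.Trace
import Mathlib.LinearAlgebra.Matrix.StdBasis
import Literature.MathematicalPhysics.QuantumLattice.LiebRobinson
import Literature.MathematicalPhysics.QuantumLattice.ProductOperators
import Literature.MathematicalPhysics.QuantumLattice.MatrixProductStatesPeriodicGroundStateProofs
import Literature.MathematicalPhysics.QuantumLattice.SpinChainsAkltCorrelationProofs
import HarnessLib

/-!
# Ring correlations of a periodic MPS as traces of transfer operators

Helper file towards the discharge of
`Literature.MathematicalPhysics.QuantumLattice.fannes_nachtergaele_werner_decay`
(`LiebRobinson.lean`): the transfer-operator expression of expectation values in the periodic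
matrix product state `ψ_L = ringMPS L A` on the ring `ℤ/L` (Fannes–Nachtergaele–Werner 1992,
eq. (3.1) and §5 eq. (5.5)/(5.8); Perez-Garcia–Verstraete–Wolf–Cirac 2007, §3.2.2). Theorems only;
no definition, no named fact. The *generalised transfer operator* of a single-site matrix `g`,
`𝔼_g(X) = Σ_{i j} g_{i j} A^j X (A^i)†` (so that `𝔼_1 = 𝔼 = transferOp A`), is written inline as
`∑ i, ∑ j, g i j • LinearMap.mulLeftRight ℂ (A j, (A i)ᴴ)`.

* `opExpect_productOp_ringMPS` — for a product operator `⨂_x G_x` on the ring,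
  `⟨ψ_L, (⨂ G) ψ_L⟩ = Tr_{End(M_D)} (𝔼_{G 0} 𝔼_{G 1} ⋯ 𝔼_{G (L-1)})` (sites read along
  `ZMod.finEquiv`);
* `opExpect_one_ringMPS` — `⟨ψ_L, ψ_L⟩ = Tr 𝔼^L`;
* `opExpect_onSite_ringMPS` — `⟨ψ_L, a_x ψ_L⟩ = Tr (𝔼_a 𝔼^{L-1})`;
* `opExpect_onSite_mul_onSite_ringMPS` — for `(y - x).val = m + 1`, `L = m + n + 2` (so `x ≠ y`):
  `⟨ψ_L, a_x b_y ψ_L⟩ = Tr (𝔼_a 𝔼^m 𝔼_b 𝔼^n)`;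
* `ringDist_eq_min` — in the same situation `ringDist x y = min (m + 1) (n + 1)`.

Ingredients: the entrywise product structure `productOp` (`ProductOperators`), the
non-commutative expansion of a product of sums (`prod_ofFn_sum` of
`SpinChainsAkltCorrelationProofs`, which treats the AKLT ring by the same transfer-matrix
bookkeeping in Kronecker form), `Tr (X ↦ B X C) = Tr B · Tr C`
(`trace_mulLeftRight`, via `Matrix.stdBasis`), cyclicity of `LinearMap.trace`, and the cyclic
relabelling lemmas of `MatrixProductStatesPeriodicGroundStateProofs` (`ofFn_rotate`,
`finEquiv_apply_eq_natCast`).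

## Sources

* M. Fannes, B. Nachtergaele, R. F. Werner, Comm. Math. Phys. **144** (1992) 443–490, eq. (3.1)
  (`ω(A₁ ⊗ 𝟙 ⊗ ⋯ ⊗ 𝟙 ⊗ A_m) = ρ(𝔼_{A₁} 𝔼^{m-2} 𝔼_{A_m}(𝟙))`), §5 eqs. (5.5), (5.8).
  [FannesNachtergaeleWernerCMP1992]
* D. Perez-Garcia, F. Verstraete, M. M. Wolf, J. I. Cirac, Quantum Inf. Comput. **7** (2007) 401,
  §3.2.2 (expectation values of MPS with periodic boundary conditions via `E_𝟙 = Σ A^i ⊗ Ā^i`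
  and `E_O`). [PerezGarciaVerstraeteWolfCiracQIC2007]
-/

noncomputable section

open Matrix

namespace Literature.MathematicalPhysics.QuantumLattice

section QLattice

variable {q D : ℕ}

/-! ### Products of lists in an algebra -/

section Lists

variable {R : Type*} [Semiring R]

/-- Scalars factor out of an ordered product in an algebra: `Π_k (c_k • M_k) = (Π_k c_k) • Π_k M_k`
(the matrix case is `prod_ofFn_smul` of `SpinChainsAkltCorrelationProofs`). [folklore] -/
theorem prod_ofFn_smul_of_algebra {S : Type*} [CommSemiring S] [Algebra S R] (L : ℕ) (c : Fin L → S)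
    (M : Fin L → R) :
    (List.ofFn fun k => c k • M k).prod = (∏ k, c k) • (List.ofFn M).prod := by
  induction L with
  | zero => simp
  | succ L ih =>
    rw [List.ofFn_succ, List.prod_cons, ih, List.ofFn_succ, List.prod_cons, Fin.prod_univ_succ,
      smul_mul_smul_comm]

end Lists

/-! ### The maps `X ↦ B X C` -/

section MulLeftRight

variable {n : Type*} [Fintype n] [DecidableEq n]

/-- Composition of two-sided multiplications: `(X ↦ a X b) ∘ (X ↦ c X d) = (X ↦ (a c) X (d b))`.
[folklore] -/
theorem mulLeftRight_mul (a b c d : Matrix n n ℂ) :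
    LinearMap.mulLeftRight ℂ (a, b) * LinearMap.mulLeftRight ℂ (c, d) =
      LinearMap.mulLeftRight ℂ (a * c, d * b) := by
  ext X : 1
  simp only [Module.End.mul_apply, LinearMap.mulLeftRight_apply, Matrix.mul_assoc]

/-- `X ↦ 1 X 1` is the identity. [folklore] -/
theorem mulLeftRight_one :
    LinearMap.mulLeftRight ℂ ((1 : Matrix n n ℂ), (1 : Matrix n n ℂ)) = 1 := by
  ext X : 1
  simp

/-- Ordered products of two-sided multiplications:
`Π_k (X ↦ P_k X Q_kᴴ) = (X ↦ (Π_k P_k) X (Π_k Q_k)ᴴ)`. [folklore] -/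
theorem prod_ofFn_mulLeftRight {L : ℕ} (P Q : Fin L → Matrix n n ℂ) :
    (List.ofFn fun k => LinearMap.mulLeftRight ℂ (P k, (Q k)ᴴ)).prod =
      LinearMap.mulLeftRight ℂ ((List.ofFn P).prod, ((List.ofFn Q).prod)ᴴ) := by
  induction L with
  | zero => simp [mulLeftRight_one]
  | succ L ih =>
    rw [List.ofFn_succ, List.prod_cons, ih, mulLeftRight_mul, List.ofFn_succ, List.ofFn_succ,
      List.prod_cons, List.prod_cons, conjTranspose_mul]

/-- **Trace of a two-sided multiplication**: `Tr_{End(M_n)} (X ↦ B X C) = Tr B · Tr C` (compute in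
the basis of matrix units). [folklore] -/
theorem trace_mulLeftRight (B C : Matrix n n ℂ) :
    LinearMap.trace ℂ _ (LinearMap.mulLeftRight ℂ (B, C)) = B.trace * C.trace := by
  have hrepr : ∀ (M : Matrix n n ℂ) (p : n × n), (Matrix.stdBasis ℂ n n).repr M p = M p.1 p.2 := by
    intro M p
    simp [Matrix.stdBasis]
  rw [LinearMap.trace_eq_matrix_trace ℂ (Matrix.stdBasis ℂ n n), Matrix.trace]
  simp only [Matrix.diag_apply, LinearMap.toMatrix_apply, LinearMap.mulLeftRight_apply, hrepr,
    Matrix.mul_apply]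
  rw [Matrix.trace, Matrix.trace, Finset.sum_mul_sum, ← Finset.univ_product_univ,
    Finset.sum_product]
  refine Finset.sum_congr rfl fun i _ => Finset.sum_congr rfl fun j _ => ?_
  simp only [Matrix.stdBasis_eq_single, Matrix.single_apply]
  simp [ite_and]

/-- Cyclicity of the trace of endomorphisms along a list: `Tr (M_k ⋯ M_{n-1} M₀ ⋯ M_{k-1}) =
Tr (M₀ ⋯ M_{n-1})`. [folklore] -/
theorem trace_prod_rotate_end {V : Type*} [AddCommGroup V] [Module ℂ V]
    (l : List (Module.End ℂ V)) (k : ℕ) :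
    LinearMap.trace ℂ V (l.rotate k).prod = LinearMap.trace ℂ V l.prod := by
  rw [List.rotate_eq_drop_append_take_mod, List.prod_append, LinearMap.trace_mul_comm,
    ← List.prod_append, List.take_append_drop]

end MulLeftRight

/-! ### Expectation values of product operators in the periodic MPS -/

/-- The product of generalised transfer operators along the chain expands into words:
`Π_k 𝔼_{G k} = Σ_{σ τ} (Π_k G k σ_k τ_k) • (X ↦ A^τ X (A^σ)†)`. [folklore] -/
theorem prod_ofFn_transferOpGen (A : MPSTensor q D) {L : ℕ} (G : Fin L → Matrix (Fin q) (Fin q) ℂ) :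
    (List.ofFn fun k : Fin L =>
        ∑ i : Fin q, ∑ j : Fin q, G k i j • LinearMap.mulLeftRight ℂ (A j, (A i)ᴴ)).prod =
      ∑ σ : Fin L → Fin q, ∑ τ : Fin L → Fin q, (∏ k, G k (σ k) (τ k)) •
        LinearMap.mulLeftRight ℂ (wordProduct A τ, (wordProduct A σ)ᴴ) := by
  have h1 : (List.ofFn fun k : Fin L =>
      ∑ i : Fin q, ∑ j : Fin q, G k i j • LinearMap.mulLeftRight ℂ (A j, (A i)ᴴ)) =
      List.ofFn fun k : Fin L => ∑ p : Fin q × Fin q,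
        G k p.1 p.2 • LinearMap.mulLeftRight ℂ (A p.2, (A p.1)ᴴ) := by
    refine congrArg List.ofFn (funext fun k => ?_)
    rw [Fintype.sum_prod_type]
  rw [h1, prod_ofFn_sum]
  rw [← (Equiv.arrowProdEquivProdArrow (Fin L) (fun _ => Fin q) fun _ => Fin q).symm.sum_comp,
    Fintype.sum_prod_type]
  refine Finset.sum_congr rfl fun σ _ => Finset.sum_congr rfl fun τ _ => ?_
  rw [prod_ofFn_smul_of_algebra, prod_ofFn_mulLeftRight]
  rfl

/-- **Expectation of a product operator in the periodic MPS (chain form).** For the translation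
invariant MPS `ψ(σ) = tr (A^{σ₀} ⋯ A^{σ_{L-1}})` on `Fin L` and single-site matrices `G k`,
`⟨ψ, (⨂_k G k) ψ⟩ = Tr_{End(M_D)} (𝔼_{G 0} ⋯ 𝔼_{G (L-1)})` with
`𝔼_g(X) = Σ_{ij} g_{ij} A^j X (A^i)†`.
Fannes–Nachtergaele–Werner (1992) eq. (3.1) and (5.8); Perez-Garcia–Verstraete–Wolf–Cirac
(2007) §3.2.2. [cite: FannesNachtergaeleWernerCMP1992, eq. (3.1)] -/
theorem star_mpsPeriodic_dotProduct_productOp_mulVec (L : ℕ) (A : MPSTensor q D)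
    (G : Fin L → Matrix (Fin q) (Fin q) ℂ) :
    star (mpsPeriodic L A) ⬝ᵥ (productOp G *ᵥ mpsPeriodic L A) =
      LinearMap.trace ℂ _ ((List.ofFn fun k : Fin L =>
        ∑ i : Fin q, ∑ j : Fin q, G k i j • LinearMap.mulLeftRight ℂ (A j, (A i)ᴴ)).prod) := by
  rw [prod_ofFn_transferOpGen, map_sum]
  simp only [map_sum, map_smul, trace_mulLeftRight, trace_conjTranspose, smul_eq_mul]
  simp only [dotProduct, mulVec, Pi.star_apply, productOp_apply, mpsPeriodic_apply,
    Finset.mul_sum]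
  refine Finset.sum_congr rfl fun σ _ => Finset.sum_congr rfl fun τ _ => ?_
  rw [Complex.star_def]
  ring

/-- Transport of a product operator on the ring `ℤ/L` to the chain `Fin L` along
`ZMod.finEquiv`: entries agree after relabelling both configurations. [folklore] -/
theorem productOp_comp_finEquiv (L : ℕ) [NeZero L] (G : ZMod L → Matrix (Fin q) (Fin q) ℂ)
    (σ τ : TensorIndex (Fin L) q) :
    productOp G (σ ∘ (ZMod.finEquiv L).symm) (τ ∘ (ZMod.finEquiv L).symm) =
      productOp (G ∘ ZMod.finEquiv L) σ τ := by
  rw [productOp_apply, productOp_apply]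
  rw [← (ZMod.finEquiv L).toEquiv.prod_comp]
  refine Finset.prod_congr rfl fun k _ => ?_
  simp

/-- **Expectation of a product operator in the periodic MPS on the ring.**
`⟨ψ_L, (⨂_x G_x) ψ_L⟩ = Tr_{End(M_D)} (𝔼_{G(0)} 𝔼_{G(1)} ⋯ 𝔼_{G(L-1)})` for `ψ_L = ringMPS L A`,
sites enumerated by `ZMod.finEquiv L`. Fannes–Nachtergaele–Werner (1992) eq. (3.1);
Perez-Garcia–Verstraete–Wolf–Cirac (2007) §3.2.2.
[cite: FannesNachtergaeleWernerCMP1992, eq. (3.1)] -/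
theorem opExpect_productOp_ringMPS (L : ℕ) [NeZero L] (A : MPSTensor q D)
    (G : ZMod L → Matrix (Fin q) (Fin q) ℂ) :
    opExpect (productOp G) (ringMPS L A) =
      LinearMap.trace ℂ _ ((List.ofFn fun k : Fin L =>
        ∑ i : Fin q, ∑ j : Fin q, G (ZMod.finEquiv L k) i j •
          LinearMap.mulLeftRight ℂ (A j, (A i)ᴴ)).prod) := by
  rw [← star_mpsPeriodic_dotProduct_productOp_mulVec]
  -- relabel both configuration sums along `e σ' = σ' ∘ finEquiv⁻¹`
  set e : TensorIndex (Fin L) q ≃ TensorIndex (ZMod L) q :=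
    (ZMod.finEquiv L).toEquiv.arrowCongr (Equiv.refl (Fin q)) with he
  have he_apply : ∀ σ : TensorIndex (Fin L) q, e σ = σ ∘ (ZMod.finEquiv L).symm := fun σ => rfl
  have hψ : ∀ σ : TensorIndex (Fin L) q,
      ringMPS L A (σ ∘ (ZMod.finEquiv L).symm) = mpsPeriodic L A σ := by
    intro σ
    show mpsPeriodic L A ((σ ∘ (ZMod.finEquiv L).symm) ∘ ZMod.finEquiv L) = _
    congr 1
    funext k
    simp
  unfold opExpect
  simp only [dotProduct, mulVec, Pi.star_apply]
  rw [← e.sum_comp]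
  refine Finset.sum_congr rfl fun σ _ => ?_
  rw [← e.sum_comp]
  simp only [he_apply, hψ, productOp_comp_finEquiv]
  rfl

/-! ### Specialisations: norm, one-point and two-point functions -/

/-- `𝔼_1 = 𝔼`: the generalised transfer operator of the identity matrix is the transfer
operator. [folklore] -/
theorem transferOpGen_one (A : MPSTensor q D) :
    (∑ i : Fin q, ∑ j : Fin q, (1 : Matrix (Fin q) (Fin q) ℂ) i j •
      LinearMap.mulLeftRight ℂ (A j, (A i)ᴴ)) = transferOp A := by
  unfold transferOp
  refine Finset.sum_congr rfl fun i _ => ?_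
  simp only [Matrix.one_apply, ite_smul, one_smul, zero_smul, Finset.sum_ite_eq, Finset.mem_univ,
    if_true]

/-- **Norm of the periodic MPS**: `⟨ψ_L, ψ_L⟩ = Tr 𝔼^L`. Fannes–Nachtergaele–Werner (1992) §5
(5.8) with `A = 𝟙`; Perez-Garcia–Verstraete–Wolf–Cirac (2007) §3.2.2.
[cite: FannesNachtergaeleWernerCMP1992, §5 eq. (5.8)] -/
theorem opExpect_one_ringMPS (L : ℕ) [NeZero L] (A : MPSTensor q D) :
    opExpect 1 (ringMPS L A) = LinearMap.trace ℂ _ (transferOp A ^ L) := by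
  rw [← productOp_one, opExpect_productOp_ringMPS]
  simp only [transferOpGen_one, List.ofFn_const, List.prod_replicate]

/-- Reading the chain of generalised transfer operators from site `x` of the ring (cyclicity of
the trace): `Tr Π_k 𝔼_{G(k)} = Tr Π_i 𝔼_{G(x+i)}`. [folklore] -/
theorem trace_prod_transferOpGen_rotate (L : ℕ) [NeZero L] (A : MPSTensor q D)
    (G : ZMod L → Matrix (Fin q) (Fin q) ℂ) (x : ZMod L) :
    LinearMap.trace ℂ _ ((List.ofFn fun k : Fin L =>
        ∑ i : Fin q, ∑ j : Fin q, G (ZMod.finEquiv L k) i j •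
          LinearMap.mulLeftRight ℂ (A j, (A i)ᴴ)).prod) =
      LinearMap.trace ℂ _ ((List.ofFn fun k : Fin L =>
        ∑ i : Fin q, ∑ j : Fin q, G (x + ((k : ℕ) : ZMod L)) i j •
          LinearMap.mulLeftRight ℂ (A j, (A i)ᴴ)).prod) := by
  rw [← trace_prod_rotate_end _ x.val, ofFn_rotate]
  simp only [finEquiv_apply_eq_natCast, Nat.cast_add, ZMod.natCast_mod, ZMod.natCast_zmod_val]

/-- On the ring `ℤ/L`, `x + i ≠ x` for `0 < i < L`. [folklore] -/
theorem add_natCast_ne_self {L : ℕ} [NeZero L] (x : ZMod L) {i : ℕ} (hi0 : 0 < i) (hiL : i < L) :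
    x + (i : ZMod L) ≠ x := by
  intro h
  have h' : (i : ZMod L) = 0 := by simpa using h
  rw [ZMod.natCast_eq_zero_iff] at h'
  exact absurd (Nat.le_of_dvd hi0 h') (not_le.mpr hiL)

/-- **One-point function**: `⟨ψ_L, a_x ψ_L⟩ = Tr (𝔼_a 𝔼^{L-1})` (for `L = L' + 1`).
Fannes–Nachtergaele–Werner (1992) eq. (3.1) (`m = 1`); Perez-Garcia–Verstraete–Wolf–Cirac
(2007) §3.2.2. [cite: FannesNachtergaeleWernerCMP1992, eq. (3.1)] -/
theorem opExpect_onSite_ringMPS (L : ℕ) [NeZero L] (L' : ℕ) (hL : L = L' + 1) (A : MPSTensor q D)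
    (x : ZMod L) (a : Matrix (Fin q) (Fin q) ℂ) :
    opExpect (onSite x a) (ringMPS L A) =
      LinearMap.trace ℂ _ ((∑ i : Fin q, ∑ j : Fin q, a i j •
        LinearMap.mulLeftRight ℂ (A j, (A i)ᴴ)) * transferOp A ^ L') := by
  subst hL
  rw [onSite_eq_productOp, opExpect_productOp_ringMPS, trace_prod_transferOpGen_rotate _ _ _ x,
    List.ofFn_succ]
  simp only [Fin.val_zero, Nat.cast_zero, add_zero, Function.update_self, Fin.val_succ]
  congr 2
  have htail : ∀ i : Fin L', Function.update (fun _ => (1 : Matrix (Fin q) (Fin q) ℂ)) x a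
      (x + (((i : ℕ) + 1 : ℕ) : ZMod (L' + 1))) = 1 := by
    intro i
    rw [Function.update_of_ne (add_natCast_ne_self x (Nat.succ_pos _) (Nat.succ_lt_succ i.2))]
  simp only [htail, transferOpGen_one, List.ofFn_const]
  rw [List.prod_cons, List.prod_replicate]

/-- On the ring `ℤ/L`, `x + i = y` for `i < L` iff `i = (y - x).val`. [folklore] -/
theorem add_natCast_eq_iff {L : ℕ} [NeZero L] (x y : ZMod L) {i : ℕ} (hiL : i < L) :
    x + (i : ZMod L) = y ↔ i = (y - x).val := by
  constructor
  · intro h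
    rw [← h, add_sub_cancel_left, ZMod.val_natCast, Nat.mod_eq_of_lt hiL]
  · intro h
    rw [h, ZMod.natCast_zmod_val, add_sub_cancel]

/-- **Two-point function**: for `x ≠ y` on the ring `ℤ/L` with `(y - x).val = m + 1` and
`L = m + n + 2`, `⟨ψ_L, a_x b_y ψ_L⟩ = Tr (𝔼_a 𝔼^m 𝔼_b 𝔼^n)`. Fannes–Nachtergaele–Werner (1992)
eq. (3.1); Perez-Garcia–Verstraete–Wolf–Cirac (2007) §3.2.2.
[cite: FannesNachtergaeleWernerCMP1992, eq. (3.1)] -/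
theorem opExpect_onSite_mul_onSite_ringMPS (L : ℕ) [NeZero L] (m n : ℕ) (hL : L = m + n + 2)
    (A : MPSTensor q D) (x y : ZMod L) (hxy : (y - x).val = m + 1)
    (a b : Matrix (Fin q) (Fin q) ℂ) :
    opExpect (onSite x a * onSite y b) (ringMPS L A) =
      LinearMap.trace ℂ _ ((∑ i : Fin q, ∑ j : Fin q, a i j •
        LinearMap.mulLeftRight ℂ (A j, (A i)ᴴ)) * transferOp A ^ m *
        ((∑ i : Fin q, ∑ j : Fin q, b i j • LinearMap.mulLeftRight ℂ (A j, (A i)ᴴ)) *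
          transferOp A ^ n)) := by
  subst hL
  have hxy' : x ≠ y := by
    intro h
    rw [h, sub_self, ZMod.val_zero] at hxy
    exact absurd hxy (by omega)
  rw [onSite_mul_onSite_eq_productOp hxy', opExpect_productOp_ringMPS,
    trace_prod_transferOpGen_rotate _ _ _ x]
  congr 1
  -- identify the rotated list with `𝔼_a :: (𝔼^m ++ 𝔼_b :: 𝔼^n)`
  set G : ZMod (m + n + 2) → Matrix (Fin q) (Fin q) ℂ :=
    Function.update (Function.update (fun _ => 1) y b) x a with hG
  have hG0 : G (x + ((((0 : Fin (m + n + 2)) : ℕ) : ℕ) : ZMod (m + n + 2))) = a := by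
    simp [G]
  have hGi : ∀ i : ℕ, 0 < i → i < m + n + 2 →
      G (x + (i : ZMod (m + n + 2))) = if i = m + 1 then b else 1 := by
    intro i hi0 hiL
    rw [hG, Function.update_of_ne (add_natCast_ne_self x hi0 hiL)]
    by_cases hi : i = m + 1
    · rw [if_pos hi, (add_natCast_eq_iff x y hiL).mpr (hi.trans hxy.symm), Function.update_self]
    · rw [if_neg hi, Function.update_of_ne]
      intro h
      exact hi (((add_natCast_eq_iff x y hiL).mp h).trans hxy)
  have hlist : (List.ofFn fun k : Fin (m + n + 2) =>
      ∑ i : Fin q, ∑ j : Fin q, G (x + ((k : ℕ) : ZMod (m + n + 2))) i j •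
        LinearMap.mulLeftRight ℂ (A j, (A i)ᴴ)) =
      (∑ i : Fin q, ∑ j : Fin q, a i j • LinearMap.mulLeftRight ℂ (A j, (A i)ᴴ)) ::
        (List.replicate m (transferOp A) ++
          ((∑ i : Fin q, ∑ j : Fin q, b i j • LinearMap.mulLeftRight ℂ (A j, (A i)ᴴ)) ::
            List.replicate n (transferOp A))) := by
    apply List.ext_getElem
    · simp
      omega
    · intro k h₁ h₂
      rw [List.getElem_ofFn]
      rcases Nat.eq_zero_or_pos k with rfl | hk
      · simp [G]
      · rw [List.getElem_cons]
        rw [dif_neg hk.ne']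
        simp only [List.length_ofFn] at h₁
        rw [hGi k hk h₁]
        rw [List.getElem_append]
        simp only [List.length_replicate]
        by_cases hkm : k - 1 < m
        · rw [dif_pos hkm, List.getElem_replicate, if_neg (by omega), transferOpGen_one]
        · rw [dif_neg hkm, List.getElem_cons]
          by_cases hk1 : k = m + 1
          · rw [dif_pos (by omega), if_pos hk1]
          · rw [dif_neg (by omega), if_neg hk1, List.getElem_replicate, transferOpGen_one]
  rw [hlist, List.prod_cons, List.prod_append, List.prod_cons, List.prod_replicate,
    List.prod_replicate, mul_assoc]

/-! ### The ring distance -/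

/-- The periodic distance on `ℤ/L` is `min ((x - y).val) (L - (x - y).val)`. [folklore] -/
theorem ringDist_eq (L : ℕ) (x y : ZMod L) :
    ringDist x y = min (x - y).val (L - (x - y).val) := by
  unfold ringDist torusDist torusNorm
  rw [Finset.univ_unique, Finset.sup_singleton]
  rfl

/-- For `x ≠ y` on the ring `ℤ/(m+n+2)` with `(y - x).val = m + 1` the periodic distance is
`min (m + 1) (n + 1)`. [folklore] -/
theorem ringDist_eq_min (L : ℕ) (m n : ℕ) (hL : L = m + n + 2) (x y : ZMod L)
    (hxy : (y - x).val = m + 1) : ringDist x y = min (m + 1) (n + 1) := by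
  subst hL
  have hne : y - x ≠ 0 := by
    intro h
    rw [h, ZMod.val_zero] at hxy
    omega
  haveI : NeZero (y - x) := ⟨hne⟩
  rw [ringDist_eq, ← neg_sub y x, ZMod.val_neg_of_ne_zero (y - x), hxy, min_comm]
  congr 1 <;> omega

end QLattice

end Literature.MathematicalPhysics.QuantumLattice
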